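import Summits.HodgeConjecture.HodgeConjecture.Theorems.K2E3CayleyCharpolyDiscrField   -- ★ (this seat): the identity over an algebraically closed field
import Literature.Algebra.Polynomial.DiscriminantTrinomialSwan                           -- ★ `discr_map_of_monic` (the discriminant of a monic polynomial commutes with ring maps)
import Mathlib.RingTheory.Localization.Away.Basic
import Mathlib.RingTheory.Localization.FractionRing
import Mathlib.FieldTheory.IsAlgClosed.AlgebraicClosure
import Mathlib.LinearAlgebra.Matrix.MvPolynomial
import HarnessLib

/-!
# K2 · E3 ∕ U12-d kit — the Weyl discriminant through the Cayley chart, GENERAL rank, over ANY commutative ring: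
# `disc(χ_{c(A)}) · det(1 − A)^{2(N−1)} = 2^{N(N−1)} · disc(χ_A)` for `det(1 − A)` a unit, and the socket-currency form `u · det(1 − A²)^{N−1} = 2^{N(N−1)} · disc(χ_A)`

HCML Track B «K2-LIT», cell `pub/hodgecm-mathlib`, crux H413 = `stmt-HodgeConjecture-24833` (`--supports … --as helper`), seat `hodgecm-mathlib-K2E3-p12` (g0),
socket #12 `sig_K2E3NormalizedCharBddNearSemisimple`, rung (S-c) «Weyl discriminant along the Cayley slice» (dealer K2E3-plan (g1) DEALS BATCH #1).  The rank-3 case is ★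
`Literature.LinearAlgebra.Matrix.discr_charpoly_cayley_mul_det_pow_four` (`2⁶`, `det⁴`, explicit cubic discriminant); ★ `K2E3CayleyCharpolyDiscrField` (this seat) proves the
general-rank identity over algebraically closed fields through the roots.  THIS FILE transfers it to EVERY commutative ring `R` and every `A ∈ M_N(R)` with
`det(1 − A)` a unit, by the UNIVERSAL MATRIX: `X = (X_ij)` over `S = ℤ[X_ij]`, localised at `d = det(1 − X)` (`S_d`, a domain in which `d` is a unit), embedded in an
algebraic closure `L` of `Frac S_d` (where §4 of the field file applies), and specialised to `(R, A)` through `IsLocalization.Away.lift` of the evaluation `X_ij ↦ A_ij`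
(which inverts `d ↦ det(1 − A)`).  Naturality of every term under ring maps: `charpoly` (Mathlib `Matrix.charpoly_map`), `disc` of a MONIC polynomial (★ `discr_map_of_monic`),
`det`, and the Cayley transform itself (`map_cayley`: `(1 − A)⁻¹` maps to `(1 − A′)⁻¹` because `det(1 − A)` is a unit).
* §1 `map_cayley`, `map_cayleyDiscrLHS`∕`RHS` — naturality.   * §2 `discr_charpoly_cayley_mul_det_pow_localization` — the identity for the universal matrix over `S_d`.
* §3 **`discr_charpoly_cayley_mul_det_pow`** — the identity over any commutative ring (hypothesis `IsUnit (1 − A).det`), and the SOCKET-CURRENCY form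
  **`unit_mul_det_one_sub_sq_pow_eq`**: if `u · det(c(A))^{N−1} = disc(χ_{c(A)})` (the unit relation of ★ `normalizedCharacter_locallyBounded` ∕ socket #12 at `g = c(A)`) and
  `det(1 + A)` is a unit too, then `u · (det(1 − A)·det(1 + A))^{N−1} = 2^{N(N−1)} · disc(χ_A)` — so along a Cayley slice through a CENTRAL point the socket's weight `√√‖u‖` is
  `√√‖2^{N(N−1)} disc(χ_Y)‖` up to the locally constant unit `‖det(1 − Y²)‖^{−(N−1)∕4}`: the group weight IS the Lie-algebra weight `|η(Y)|^{1∕2}` [HarishChandra1999 §17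
  «`|η_𝔤(X)| = |D_G(exp X)|`», here for the Cayley chart instead of `exp`].
THEOREMS ONLY (no `def`, no instance, no notation, no `sorry`, axioms ⊆ the trio).  HONEST LABEL: pure algebra; HC_CM is proved only modulo the 7 printed citations
(2 remaining named inputs: hLiu418 = stmt-HodgeConjecture-24832, h413 = stmt-HodgeConjecture-24833) until rung 0 closes.

## References
* [PlatonovRapinchuk1994] V. Platonov, A. Rapinchuk, *Algebraic Groups and Number Theory* (1994), §3.3 (Cayley parametrisation).
* [BasuPollackRoy2006] S. Basu, R. Pollack, M.-F. Roy, *Algorithms in Real Algebraic Geometry*, 2nd ed. (2006), Ch. 4 §4.1, §4.3.1 (discriminants; of `CharPol(M)` as a polynomial in the entries).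
* [HarishChandra1999AdmissibleDistributions] Harish-Chandra (DeBacker–Sally), *Admissible Invariant Distributions on Reductive p-adic Groups* (1999), §17.
-/

set_option autoImplicit false
set_option linter.dupNamespace false

open Polynomial

namespace Summit.HodgeConjecture.HodgeConjecture.Cruxes.H413.K2E3CayleyCharpolyDiscr

open Summit.HodgeConjecture.HodgeConjecture.Cruxes.H413.K2E3CayleyCharpolyDiscrField

/-! ## §1 Naturality under ring maps -/

section Naturality

variable {B B' : Type*} [CommRing B] [CommRing B'] (φ : B →+* B') {N : ℕ}

/-- A ring map sends the inverse of a matrix with unit determinant to the inverse of its image. [folklore] -/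
theorem map_nonsing_inv_of_isUnit (M : Matrix (Fin N) (Fin N) B) (h : IsUnit M.det) : (M⁻¹).map φ = (M.map φ)⁻¹ := by
  symm
  apply Matrix.inv_eq_right_inv
  rw [← Matrix.map_mul, Matrix.mul_nonsing_inv _ h, Matrix.map_one φ (map_zero φ) (map_one φ)]

/-- **The Cayley transform commutes with ring maps** when `det(1 − A)` is a unit: `c(A).map φ = c(A.map φ)`. [cite: PlatonovRapinchuk1994, §3.3] -/
theorem map_cayley (A : Matrix (Fin N) (Fin N) B) (h : IsUnit (1 - A).det) :
    ((1 + A) * (1 - A)⁻¹).map φ = (1 + A.map φ) * (1 - A.map φ)⁻¹ := by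
  rw [Matrix.map_mul, map_nonsing_inv_of_isUnit φ _ h, Matrix.map_sub _ (map_sub φ), Matrix.map_add _ (map_add φ),
    Matrix.map_one φ (map_zero φ) (map_one φ)]

/-- `φ(det(1 − A)) = det(1 − A.map φ)`. [folklore] -/
theorem map_det_one_sub (A : Matrix (Fin N) (Fin N) B) : φ (1 - A).det = (1 - A.map φ).det := by
  rw [RingHom.map_det, RingHom.mapMatrix_apply, Matrix.map_sub _ (map_sub φ), Matrix.map_one φ (map_zero φ) (map_one φ)]

/-- `φ(disc χ_A) = disc χ_{A.map φ}` (Mathlib `charpoly_map` + ★ `discr_map_of_monic`; `χ` is monic). [cite: BasuPollackRoy2006, Ch. 4 §4.3.1] -/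
theorem map_discr_charpoly (A : Matrix (Fin N) (Fin N) B) : φ A.charpoly.discr = (A.map φ).charpoly.discr := by
  rw [Matrix.charpoly_map, Literature.Algebra.Polynomial.DiscriminantTrinomialSwan.discr_map_of_monic φ (Matrix.charpoly_monic A)]

/-- Naturality of the two sides of the identity. [cite: BasuPollackRoy2006, Ch. 4 §4.3.1] -/
theorem map_cayleyDiscr_sides (A : Matrix (Fin N) (Fin N) B) (h : IsUnit (1 - A).det) :
    φ (((1 + A) * (1 - A)⁻¹).charpoly.discr * (1 - A).det ^ (2 * (N - 1))) =
      ((1 + A.map φ) * (1 - A.map φ)⁻¹).charpoly.discr * (1 - A.map φ).det ^ (2 * (N - 1)) ∧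
    φ (2 ^ (N * (N - 1)) * A.charpoly.discr) = 2 ^ (N * (N - 1)) * (A.map φ).charpoly.discr := by
  constructor
  · rw [map_mul, map_pow, map_discr_charpoly, map_cayley φ A h, map_det_one_sub]
  · rw [map_mul, map_pow, map_ofNat, map_discr_charpoly]

end Naturality

/-! ## §2 The universal matrix, localised at `det(1 − X)` -/

section Universal

variable (N : ℕ)

/-- `det(1 − X) ≠ 0` for the universal matrix `X = (X_ij)` over `ℤ[X_ij]` (evaluate at `X = 0`). [folklore] -/
theorem det_one_sub_mvPolynomialX_ne_zero :
    (1 - Matrix.mvPolynomialX (Fin N) (Fin N) ℤ).det ≠ 0 := by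
  intro h0
  have h := congrArg (MvPolynomial.eval fun p : Fin N × Fin N => (0 : Matrix (Fin N) (Fin N) ℤ) p.1 p.2) h0
  rw [map_det_one_sub, map_zero] at h
  have hX : (Matrix.mvPolynomialX (Fin N) (Fin N) ℤ).map (MvPolynomial.eval fun p : Fin N × Fin N => (0 : Matrix (Fin N) (Fin N) ℤ) p.1 p.2) = 0 :=
    Matrix.mvPolynomialX_map_eval₂ _ (0 : Matrix (Fin N) (Fin N) ℤ)
  rw [hX, sub_zero, Matrix.det_one] at h
  exact one_ne_zero h

/-- **The identity for the universal matrix over `S_d = ℤ[X_ij][det(1 − X)⁻¹]`**: `S_d` is a domain in which `det(1 − X)` is a unit, it embeds in an algebraically closed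
field `L`, the identity holds for the image of `X` in `M_N(L)` (★ `discr_charpoly_cayley_mul_det_pow_of_isAlgClosed`), and both sides are natural (§1), so it holds in `S_d`.
[cite: BasuPollackRoy2006, Ch. 4 §4.3.1] -/
theorem discr_charpoly_cayley_mul_det_pow_localization :
    ((1 + (Matrix.mvPolynomialX (Fin N) (Fin N) ℤ).map
          (algebraMap (MvPolynomial (Fin N × Fin N) ℤ) (Localization.Away (1 - Matrix.mvPolynomialX (Fin N) (Fin N) ℤ).det))) *
        (1 - (Matrix.mvPolynomialX (Fin N) (Fin N) ℤ).map
          (algebraMap (MvPolynomial (Fin N × Fin N) ℤ) (Localization.Away (1 - Matrix.mvPolynomialX (Fin N) (Fin N) ℤ).det)))⁻¹).charpoly.discr *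
      (1 - (Matrix.mvPolynomialX (Fin N) (Fin N) ℤ).map
          (algebraMap (MvPolynomial (Fin N × Fin N) ℤ) (Localization.Away (1 - Matrix.mvPolynomialX (Fin N) (Fin N) ℤ).det))).det ^ (2 * (N - 1)) =
    2 ^ (N * (N - 1)) * ((Matrix.mvPolynomialX (Fin N) (Fin N) ℤ).map
          (algebraMap (MvPolynomial (Fin N × Fin N) ℤ) (Localization.Away (1 - Matrix.mvPolynomialX (Fin N) (Fin N) ℤ).det))).charpoly.discr := by
  set S := MvPolynomial (Fin N × Fin N) ℤ with hS
  set d : S := (1 - Matrix.mvPolynomialX (Fin N) (Fin N) ℤ).det with hd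
  set Sd := Localization.Away d with hSd
  set X := (Matrix.mvPolynomialX (Fin N) (Fin N) ℤ).map (algebraMap S Sd) with hX
  have hd0 : d ≠ 0 := det_one_sub_mvPolynomialX_ne_zero N
  haveI : IsDomain Sd := IsLocalization.isDomain_localization (powers_le_nonZeroDivisors_of_noZeroDivisors hd0)
  -- `det(1 − X) = d` is a unit of `S_d`
  have hXu : IsUnit (1 - X).det := by
    rw [hX, ← map_det_one_sub (algebraMap S Sd)]
    exact IsLocalization.Away.algebraMap_isUnit d
  -- embed `S_d` in an algebraic closure of its fraction field
  set L := AlgebraicClosure (FractionRing Sd) with hL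
  set ι : Sd →+* L := (algebraMap (FractionRing Sd) L).comp (algebraMap Sd (FractionRing Sd)) with hι
  have hιinj : Function.Injective ι := (algebraMap (FractionRing Sd) L).injective.comp (IsFractionRing.injective Sd (FractionRing Sd))
  have hL0 : (1 - X.map ι).det ≠ 0 := by
    rw [← map_det_one_sub ι X]
    intro h0
    exact hXu.ne_zero (hιinj (by rw [h0, map_zero]))
  have hfield := discr_charpoly_cayley_mul_det_pow_of_isAlgClosed (X.map ι) hL0
  obtain ⟨h1, h2⟩ := map_cayleyDiscr_sides ι X hXu
  exact hιinj (by rw [h1, h2, hfield])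

end Universal

/-! ## §3 The identity over any commutative ring, and the socket-currency form -/

section AnyRing

variable {R : Type*} [CommRing R] {N : ℕ}

/-- **The Weyl discriminant through the Cayley chart, any rank, any commutative ring**: for `A ∈ M_N(R)` with `det(1 − A)` a unit,
`disc(χ_{c(A)}) · det(1 − A)^{2(N−1)} = 2^{N(N−1)} · disc(χ_A)`, `c(A) = (1 + A)(1 − A)⁻¹` (specialise §2 along `IsLocalization.Away.lift` of `X_ij ↦ A_ij`).
The rank-3 case is ★ `discr_charpoly_cayley_mul_det_pow_four`. [cite: BasuPollackRoy2006, Ch. 4 §4.3.1] [cite: PlatonovRapinchuk1994, §3.3] -/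
theorem discr_charpoly_cayley_mul_det_pow (A : Matrix (Fin N) (Fin N) R) (h : IsUnit (1 - A).det) :
    ((1 + A) * (1 - A)⁻¹).charpoly.discr * (1 - A).det ^ (2 * (N - 1)) = 2 ^ (N * (N - 1)) * A.charpoly.discr := by
  set S := MvPolynomial (Fin N × Fin N) ℤ with hS
  set d : S := (1 - Matrix.mvPolynomialX (Fin N) (Fin N) ℤ).det with hd
  set Sd := Localization.Away d with hSd
  -- the evaluation `X_ij ↦ A_ij` inverts `d ↦ det(1 − A)`, hence factors through `S_d`
  set e : S →+* R := MvPolynomial.eval₂Hom (Int.castRingHom R) (fun p : Fin N × Fin N => A p.1 p.2) with he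
  have hXe : (Matrix.mvPolynomialX (Fin N) (Fin N) ℤ).map e = A := Matrix.mvPolynomialX_map_eval₂ _ A
  have hed : e d = (1 - A).det := by rw [hd, map_det_one_sub, hXe]
  have heu : IsUnit (e d) := by rw [hed]; exact h
  set ê : Sd →+* R := IsLocalization.Away.lift d heu with hê
  have hcomp : ê.comp (algebraMap S Sd) = e := IsLocalization.Away.lift_comp d heu
  set X := (Matrix.mvPolynomialX (Fin N) (Fin N) ℤ).map (algebraMap S Sd) with hX
  have hXA : X.map ê = A := by rw [hX, Matrix.map_map, ← RingHom.coe_comp, hcomp, hXe]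
  have hXu : IsUnit (1 - X).det := by
    rw [← map_det_one_sub (algebraMap S Sd)]
    exact IsLocalization.Away.algebraMap_isUnit d
  have huniv := discr_charpoly_cayley_mul_det_pow_localization N
  obtain ⟨h1, h2⟩ := map_cayleyDiscr_sides ê X hXu
  rw [hXA] at h1 h2
  rw [← h1, ← h2]
  exact congrArg ê huniv

/-- **Socket-currency form (the unit relation of ★ `normalizedCharacter_locallyBounded` ∕ socket #12 at a Cayley point)**: if `u · det(c(A))^{N−1} = disc(χ_{c(A)})` with
`det(1 − A)` and `det(1 + A)` units, then `u · (det(1 − A) · det(1 + A))^{N−1} = 2^{N(N−1)} · disc(χ_A)` (★ `det_cayley_mul_det`: `det(c(A))·det(1 − A) = det(1 + A)`).  Along a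
Cayley slice through a central point this says that the group weight `|D_G(c(Y))| = ‖u‖` is `‖2^{N(N−1)} disc(χ_Y)‖` times the locally constant unit `‖det(1 − Y²)‖^{−(N−1)}`.
[cite: HarishChandra1999AdmissibleDistributions, §17] [cite: PlatonovRapinchuk1994, §3.3] -/
theorem unit_mul_det_pow_eq_of_cayley (A : Matrix (Fin N) (Fin N) R) (h : IsUnit (1 - A).det) (u : R)
    (hu : u * (((1 + A) * (1 - A)⁻¹).det) ^ (N - 1) = ((1 + A) * (1 - A)⁻¹).charpoly.discr) :
    u * ((1 - A).det * (1 + A).det) ^ (N - 1) = 2 ^ (N * (N - 1)) * A.charpoly.discr := by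
  have hc : ((1 + A) * (1 - A)⁻¹).det * (1 - A).det = (1 + A).det := Literature.LinearAlgebra.Matrix.det_cayley_mul_det A h
  rw [← discr_charpoly_cayley_mul_det_pow A h, ← hu, ← hc]
  ring

end AnyRing

end Summit.HodgeConjecture.HodgeConjecture.Cruxes.H413.K2E3CayleyCharpolyDiscr
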